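/-
Copyright (c) 2026. All rights reserved.
Released under Apache 2.0 license as described in the file LICENSE.
Authors: HodgeCM publication cell (pub-hodgecm2), Δ2-bridge adapter seat adapt-2.
-/
import Literature.NumberTheory.Weil1964.AdelicSchrodingerConjCont
import Literature.NumberTheory.Weil1964.AdelicDoublingDiagonalLift
import Literature.NumberTheory.GelbartRogawski1991.UnitaryDualPairSplittingDatum
import HarnessLib

/-!
# Complex conjugation carries Weil's rational section of `Mp_ψ(W_T)` to that of `Mp_ψ(W_{−T})`

Topic `NumberTheory/Weil1964`; namespaces `Literature.RepresentationTheory.HeisenbergGroup.SymplecticMatrix` (§1, pure linear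
algebra next to `transportSp ∕ mapHom`) and `Literature.NumberTheory.Weil1964` (§2–§3).  KERNEL MATHEMATICS ONLY: one definition by
formula (`negOffDiag`) + theorems; no `def … : Prop`, no `axiom`, no proof hole.  This is the «`T`-dependent Darboux bookkeeping» listed as
NOT-HERE (i) in `AdelicSchrodingerConj{,Cont}.lean` (mc-unitary-3): the conjugate model `adelicMpContConj F ι T : Mp_ψ(W_T)ᶜᵒⁿᵗ ≃*
Mp_ψ(W_{−T})ᶜᵒⁿᵗ`, `(g, M) ↦ (g, C M C)`, covers the IDENTITY of `Sp(W_T)(𝔸) = Sp(W_{−T})(𝔸) ≤ GL(W_𝔸)`, but the tree PARAMETRISES the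
rational points by Mathlib's `Sp_{2n}(F)` through the `T`-dependent Darboux transport `ratSp F T = transportSp T ∘ mapHom` (`(x, y) ↦ (x, T y)`),
so the same rational automorphism of `W_𝔸` has DIFFERENT matrices for `T` and `−T`: they differ by conjugation with the similitude
`Λ = diag(1, −1)` of multiplier `−1`.

* §1 `negOffDiag : Sp_{2ι}(K) ≃* Sp_{2ι}(K)`, `A = (a b; c d) ↦ Λ A Λ = (a −b; −c d)` (an involutive automorphism, natural under change of
  scalars `mapHom`), and **`coe_transportSp_neg : transportSp (−T) (Λ A Λ) = transportSp T A` in `GL(W)`** (block formula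
  `coe_transportSp_apply_blocks`).
* §2 `adelicSymplecticNeg (ratSp F T hT γ) = ratSp F (−T) _ (negOffDiag γ)` and **`adelicMpContConj F (Fin n) T (r_T γ) = r_{−T} (Λ γ Λ)`**
  for Weil's Θ-rigid rational lift `r_T = ratThetaLiftCont F T hT` — by Θ-RIGIDITY in `Mp_ψ(W_{−T})` (`coe_ratThetaLiftCont_eq`): the conjugate pair
  fixes `Θ` (`adelicMpContConj_mem_adelicMpTheta_iff`) and lies over `ratSp (−T) (Λ γ Λ)` (`proj_adelicMpConj` + §1).
* §3 the RANGE form for [GelbartRogawski1991]'s section `i = ratSection`: `p ∈ range (ratSection F T hT) → pᶜ ∈ range (ratSection F (−T) _)` — the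
  `ratPts` clause of `SplittingDatum.IsCompatible` for a conjugate-transported splitting (the `proj` clause is `coe_proj_adelicMpContConj`).

USE (pub-hodgecm2, Track T (T4b″)): recognising the conjugate finite Weil representation `(finPairRep hs)ᶜ` of a unitary dual pair
(✔ `AdelicMetaplecticFinRepConj`, ✔ `WeilCoinvConj`) as `finPairRep hs̄` for an honest COMPATIBLE pair splitting `s̄` at the negated line needs
`IsCompatible s̄`; §3 is its rational-points half.

## References
* [Weil1964] A. Weil, *Sur certains groupes d'opérateurs unitaires*, Acta Math. 111 (1964), Chap. III n° 40 p. 190 (the section `r_k`), n° 41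
  Thm 6 p. 193 (its operators fix `Θ`).
* [MoeglinVignerasWaldspurger1987] C. Mœglin, M.-F. Vignéras, J.-L. Waldspurger, LNM 1291 (1987), Chap. 2 II.1 (transport of structure of `S̃p_ψ(W)`).
* [GelbartRogawski1991] S. Gelbart, J. Rogawski, Invent. Math. 105 (1991), §3.1 p. 454 L35–42 (`π` splits uniquely over `Sp_F(W)`; the splitting `i`).
* [Kudla1996] S. Kudla, *Notes on the local theta correspondence* (1996), V.3 (the space `W⁻` and `Sp(W) = Sp(W⁻)`).
-/

set_option autoImplicit false

noncomputable section

open Matrix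

/-! ## §1 The similitude `Λ = diag(1, −1)`: `A ↦ Λ A Λ` on `Sp_{2ι}(K)` and the Darboux transports of `T` and `−T` -/

namespace Literature.RepresentationTheory.HeisenbergGroup.SymplecticMatrix

variable {K : Type*} [CommRing K] {ι : Type*} [Fintype ι] [DecidableEq ι]

/-- the similitude `Λ = diag(1, −1) = (1 0; 0 −1)` of the standard symplectic space `K^{ι ⊕ ι}` (multiplier `−1`). [cite: Kudla1996, V.3] -/
def negUnit : Matrix (ι ⊕ ι) (ι ⊕ ι) K := Matrix.fromBlocks 1 0 0 (-1)

/-- `Λ Λ = 1`. [cite: Kudla1996, V.3] -/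
theorem negUnit_mul_negUnit : (negUnit : Matrix (ι ⊕ ι) (ι ⊕ ι) K) * negUnit = 1 := by
  rw [negUnit, Matrix.fromBlocks_multiply]
  simp only [Matrix.mul_one, Matrix.mul_zero, add_zero, zero_add, Matrix.mul_neg, neg_neg, neg_zero, Matrix.fromBlocks_one]

/-- `Λ (Λ X) = X`. [cite: Kudla1996, V.3] -/
theorem negUnit_mul_negUnit_mul (X : Matrix (ι ⊕ ι) (ι ⊕ ι) K) : negUnit * (negUnit * X) = X := by
  rw [← Matrix.mul_assoc, negUnit_mul_negUnit, Matrix.one_mul]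

/-- `(X Λ) Λ = X`. [cite: Kudla1996, V.3] -/
theorem mul_negUnit_mul_negUnit (X : Matrix (ι ⊕ ι) (ι ⊕ ι) K) : X * negUnit * negUnit = X := by
  rw [Matrix.mul_assoc, negUnit_mul_negUnit, Matrix.mul_one]

omit [Fintype ι] in
/-- `Λᵀ = Λ`. [cite: Kudla1996, V.3] -/
theorem transpose_negUnit : (negUnit : Matrix (ι ⊕ ι) (ι ⊕ ι) K)ᵀ = negUnit := by
  rw [negUnit, Matrix.fromBlocks_transpose]
  simp only [Matrix.transpose_one, Matrix.transpose_zero, Matrix.transpose_neg]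

/-- `Λ J Λ = −J`: `Λ` is a similitude of multiplier `−1` for Mathlib's `J = (0 −1; 1 0)`. [cite: Kudla1996, V.3] -/
theorem negUnit_mul_J_mul_negUnit : (negUnit : Matrix (ι ⊕ ι) (ι ⊕ ι) K) * Matrix.J ι K * negUnit = -Matrix.J ι K := by
  rw [negUnit, Matrix.J, Matrix.fromBlocks_multiply, Matrix.fromBlocks_multiply, Matrix.fromBlocks_neg]
  simp only [Matrix.mul_one, Matrix.mul_zero, add_zero, zero_add, Matrix.mul_neg, neg_mul_neg, neg_neg, neg_zero]

/-- `Λ A Λ ∈ Sp_{2ι}(K)` for `A ∈ Sp_{2ι}(K)` (conjugation by a similitude preserves the symplectic group). [cite: Kudla1996, V.3] -/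
theorem negUnit_mul_mul_negUnit_mem (A : Matrix.symplecticGroup ι K) :
    negUnit * (A : Matrix (ι ⊕ ι) (ι ⊕ ι) K) * negUnit ∈ Matrix.symplecticGroup ι K := by
  have hA : (A : Matrix (ι ⊕ ι) (ι ⊕ ι) K) * Matrix.J ι K * (A : Matrix (ι ⊕ ι) (ι ⊕ ι) K)ᵀ = Matrix.J ι K :=
    SymplecticGroup.mem_iff.1 A.2
  rw [SymplecticGroup.mem_iff, Matrix.transpose_mul, Matrix.transpose_mul, transpose_negUnit]
  calc negUnit * (A : Matrix (ι ⊕ ι) (ι ⊕ ι) K) * negUnit * Matrix.J ι K * (negUnit * ((A : Matrix (ι ⊕ ι) (ι ⊕ ι) K)ᵀ * negUnit))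
      = negUnit * (A : Matrix (ι ⊕ ι) (ι ⊕ ι) K) * (negUnit * Matrix.J ι K * negUnit) * (A : Matrix (ι ⊕ ι) (ι ⊕ ι) K)ᵀ * negUnit := by
        simp only [Matrix.mul_assoc]
    _ = -(negUnit * ((A : Matrix (ι ⊕ ι) (ι ⊕ ι) K) * Matrix.J ι K * (A : Matrix (ι ⊕ ι) (ι ⊕ ι) K)ᵀ) * negUnit) := by
        rw [negUnit_mul_J_mul_negUnit]
        simp only [Matrix.mul_assoc, Matrix.mul_neg, Matrix.neg_mul]
    _ = Matrix.J ι K := by rw [hA, negUnit_mul_J_mul_negUnit, neg_neg]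

/-- `A ↦ Λ A Λ` on `Sp_{2ι}(K)` as a function (the two-sided inverse of itself). [cite: Kudla1996, V.3] -/
def negOffDiagFun (A : Matrix.symplecticGroup ι K) : Matrix.symplecticGroup ι K :=
  ⟨negUnit * (A : Matrix (ι ⊕ ι) (ι ⊕ ι) K) * negUnit, negUnit_mul_mul_negUnit_mem A⟩

/-- the matrix of `negOffDiagFun A`. [cite: Kudla1996, V.3] -/
@[simp] theorem coe_negOffDiagFun (A : Matrix.symplecticGroup ι K) :
    ((negOffDiagFun A : Matrix.symplecticGroup ι K) : Matrix (ι ⊕ ι) (ι ⊕ ι) K) = negUnit * (A : Matrix (ι ⊕ ι) (ι ⊕ ι) K) * negUnit :=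
  rfl

/-- `negOffDiagFun` is an involution. [cite: Kudla1996, V.3] -/
theorem negOffDiagFun_negOffDiagFun (A : Matrix.symplecticGroup ι K) : negOffDiagFun (negOffDiagFun A) = A :=
  Subtype.ext (by rw [coe_negOffDiagFun, coe_negOffDiagFun, ← Matrix.mul_assoc, negUnit_mul_negUnit_mul, mul_negUnit_mul_negUnit])

/-- `negOffDiagFun` is multiplicative (`Λ Λ = 1`). [cite: Kudla1996, V.3] -/
theorem negOffDiagFun_mul (A B : Matrix.symplecticGroup ι K) : negOffDiagFun (A * B) = negOffDiagFun A * negOffDiagFun B :=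
  Subtype.ext (by
    rw [Submonoid.coe_mul, coe_negOffDiagFun, coe_negOffDiagFun, coe_negOffDiagFun, Submonoid.coe_mul]
    simp only [Matrix.mul_assoc, negUnit_mul_negUnit_mul])

/-- **`negOffDiag : Sp_{2ι}(K) ≃* Sp_{2ι}(K)`, `A ↦ Λ A Λ`** (`(a b; c d) ↦ (a −b; −c d)`), the involutive automorphism by which the
Darboux matrices of one automorphism of `W` for the Gram matrices `T` and `−T` differ. [cite: Kudla1996, V.3] -/
def negOffDiag : Matrix.symplecticGroup ι K ≃* Matrix.symplecticGroup ι K where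
  toFun := negOffDiagFun
  invFun := negOffDiagFun
  left_inv := negOffDiagFun_negOffDiagFun
  right_inv := negOffDiagFun_negOffDiagFun
  map_mul' := negOffDiagFun_mul

/-- the matrix of `negOffDiag A` is `Λ A Λ`. [cite: Kudla1996, V.3] -/
@[simp] theorem coe_negOffDiag (A : Matrix.symplecticGroup ι K) :
    ((negOffDiag A : Matrix.symplecticGroup ι K) : Matrix (ι ⊕ ι) (ι ⊕ ι) K) = negUnit * (A : Matrix (ι ⊕ ι) (ι ⊕ ι) K) * negUnit :=
  rfl

/-- the matrix of `negOffDiag A` in blocks: `(a −b; −c d)`. [cite: Kudla1996, V.3] -/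
theorem coe_negOffDiag_eq_fromBlocks (A : Matrix.symplecticGroup ι K) :
    ((negOffDiag A : Matrix.symplecticGroup ι K) : Matrix (ι ⊕ ι) (ι ⊕ ι) K) =
      Matrix.fromBlocks (A : Matrix (ι ⊕ ι) (ι ⊕ ι) K).toBlocks₁₁ (-(A : Matrix (ι ⊕ ι) (ι ⊕ ι) K).toBlocks₁₂)
        (-(A : Matrix (ι ⊕ ι) (ι ⊕ ι) K).toBlocks₂₁) (A : Matrix (ι ⊕ ι) (ι ⊕ ι) K).toBlocks₂₂ := by
  rw [coe_negOffDiag]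
  conv_lhs => rw [← Matrix.fromBlocks_toBlocks (A : Matrix (ι ⊕ ι) (ι ⊕ ι) K)]
  rw [negUnit, Matrix.fromBlocks_multiply, Matrix.fromBlocks_multiply]
  simp only [Matrix.mul_one, Matrix.mul_zero, Matrix.zero_mul, Matrix.one_mul, add_zero, zero_add, Matrix.mul_neg,
    Matrix.neg_mul, neg_neg]

/-- `negOffDiag` is an involution. [cite: Kudla1996, V.3] -/
@[simp] theorem negOffDiag_negOffDiag (A : Matrix.symplecticGroup ι K) : negOffDiag (negOffDiag A) = A :=
  negOffDiagFun_negOffDiagFun A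

/-- `negOffDiag` commutes with change of scalars. [cite: Kudla1996, V.3] -/
theorem mapHom_negOffDiag {K' : Type*} [CommRing K'] (f : K →+* K') (A : Matrix.symplecticGroup ι K) :
    mapHom f (negOffDiag A) = negOffDiag (mapHom f A) := by
  apply Subtype.ext
  rw [coe_mapHom, coe_negOffDiag, coe_negOffDiag, coe_mapHom, Matrix.map_mul, Matrix.map_mul]
  have hΛ : (negUnit : Matrix (ι ⊕ ι) (ι ⊕ ι) K).map f = negUnit := by
    rw [negUnit, negUnit, Matrix.fromBlocks_map, Matrix.map_zero _ (map_zero f), Matrix.map_neg _ (map_neg f),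
      Matrix.map_one f (map_zero f) (map_one f)]
  rw [hΛ]

section Gram

variable (T : Matrix ι ι K) (hT : IsUnit T.det)
include hT

/-- `det (−T)` is a unit when `det T` is (`W⁻` has an invertible Gram matrix too). [cite: Kudla1996, V.3] -/
theorem isUnit_det_neg : IsUnit (-T).det := by
  rw [Matrix.det_neg]
  exact (isUnit_one.neg.pow _).mul hT

/-- `(−T)⁻¹ = −T⁻¹` (`T.det` a unit): the inverse Gram matrix of `W⁻`. [cite: Kudla1996, V.3] -/
theorem inv_neg_eq : (-T)⁻¹ = -T⁻¹ :=
  Matrix.inv_eq_left_inv (by rw [neg_mul_neg, Matrix.nonsing_inv_mul T hT])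

/-- **THE DARBOUX TRANSPORTS OF `T` AND `−T` DIFFER BY `Λ`**: `transportSp (−T) (Λ A Λ) = transportSp T A` as automorphisms of `W = K^ι × K^ι`
(both are `(x′, y′) ↦ (a x′ + b T y′, T⁻¹ (c x′ + d T y′))`, `coe_transportSp_apply_blocks`). [cite: Weil1964, Chap. III n° 46 p. 202] [cite: Kudla1996, V.3] -/
theorem coe_transportSp_neg (A : Matrix.symplecticGroup ι K) :
    ((transportSp (-T) (isUnit_det_neg T hT) (negOffDiag A) : symplecticGroup (polar (Matrix.toLinearMap₂' K (-T)))) :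
        ((ι → K) × (ι → K)) ≃ₗ[K] ((ι → K) × (ι → K))) =
      (transportSp T hT A : symplecticGroup (polar (Matrix.toLinearMap₂' K T))) := by
  refine LinearEquiv.ext fun v => ?_
  obtain ⟨x', y'⟩ := v
  rw [Literature.NumberTheory.Weil1964.coe_transportSp_apply_blocks, Literature.NumberTheory.Weil1964.coe_transportSp_apply_blocks,
    coe_negOffDiag_eq_fromBlocks, Matrix.toBlocks_fromBlocks₁₁, Matrix.toBlocks_fromBlocks₁₂, Matrix.toBlocks_fromBlocks₂₁,
    Matrix.toBlocks_fromBlocks₂₂, inv_neg_eq T hT, Matrix.neg_mulVec, Matrix.neg_mulVec, Matrix.neg_mulVec, Matrix.mulVec_neg,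
    neg_neg, Matrix.mulVec_neg, Matrix.neg_mulVec, ← neg_add, Matrix.mulVec_neg, neg_neg]

end Gram

end Literature.RepresentationTheory.HeisenbergGroup.SymplecticMatrix

/-! ## §2 `conj ∘ r_T = r_{−T} ∘ (Λ · Λ)` for Weil's Θ-rigid rational lift -/

namespace Literature.NumberTheory.Weil1964

open Literature.RepresentationTheory.HeisenbergGroup Literature.RepresentationTheory.HeisenbergGroup.SymplecticMatrix
  Literature.NumberTheory.Automorphic NumberField
open Literature.NumberTheory.GelbartRogawski1991.UnitaryDualPair (ratSection ratSection_apply)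

variable (F : Type) [Field F] [NumberField F] {n : ℕ} (T : Matrix (Fin n) (Fin n) (AdeleRing (𝓞 F) F)) (hT : IsUnit T.det)

/-- **the rational symplectic point `γ` of `Sp(W_T)(𝔸)`, viewed in `Sp(W_{−T})(𝔸)` through the identity of `GL(W_𝔸)`, is the rational point
`Λ γ Λ` of `Sp(W_{−T})`**: `adelicSymplecticNeg (ratSp F T hT γ) = ratSp F (−T) _ (negOffDiag γ)`. [cite: Weil1964, Chap. III n° 37 p. 188] [cite: Kudla1996, V.3] -/
theorem adelicSymplecticNeg_ratSp (γ : Matrix.symplecticGroup (Fin n) F) :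
    adelicSymplecticNeg F (Fin n) T (ratSp F T hT γ) = ratSp F (-T) (isUnit_det_neg T hT) (negOffDiag γ) := by
  apply Subtype.ext
  rw [coe_symplecticGroupNeg, ratSp, ratSp, MonoidHom.comp_apply, MonoidHom.comp_apply, mapHom_negOffDiag]
  exact (coe_transportSp_neg T hT (mapHom (algebraMap F (AdeleRing (𝓞 F) F)) γ)).symm

/-- **`conj (r_T(γ)) = r_{−T}(Λ γ Λ)` in `Mp_ψ(W_{−T})`** for Weil's Θ-rigid rational lift `r_T = ratThetaLiftCont F T hT`: the conjugate pair
`(ratSp γ, C M C)` fixes `Θ` (`Θ(C M C Φ) = conj Θ(M Φ̄) = Θ(Φ)`) and lies over the rational point `ratSp (−T) (Λ γ Λ)`, so Θ-rigidity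
(`coe_ratThetaLiftCont_eq`) identifies it. [cite: Weil1964, Chap. III n° 40 p. 190, n° 41 Thm 6 p. 193] [cite: MoeglinVignerasWaldspurger1987, Chap. 2 II.1] -/
theorem adelicMpConj_ratThetaLiftCont (γ : Matrix.symplecticGroup (Fin n) F) :
    adelicMpConj F (Fin n) T (ratThetaLiftCont F T hT γ : adelicMp F (Fin n) T) =
      (ratThetaLiftCont F (-T) (isUnit_det_neg T hT) (negOffDiag γ) : adelicMp F (Fin n) (-T)) :=
  (coe_ratThetaLiftCont_eq F (-T) (isUnit_det_neg T hT)
    ((adelicMpConj_mem_adelicMpTheta_iff _).2 (coe_ratThetaLiftCont_mem_adelicMpTheta F T hT γ))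
    ((proj_adelicMpConj _).trans ((congrArg (adelicSymplecticNeg F (Fin n) T) (proj_coe_ratThetaLiftCont F T hT γ)).trans
      (adelicSymplecticNeg_ratSp F T hT γ)))).symm

/-- **`(r_T(γ))ᶜ = r_{−T}(Λ γ Λ)` on the group of record** `Mp_ψ(W_𝔸)ᶜᵒⁿᵗ` (`adelicMpContConj`). [cite: Weil1964, Chap. III n° 40 p. 190, n° 41 Thm 6 p. 193]
[cite: MoeglinVignerasWaldspurger1987, Chap. 2 II.1] -/
theorem adelicMpContConj_ratThetaLiftCont (γ : Matrix.symplecticGroup (Fin n) F) :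
    adelicMpContConj F (Fin n) T (ratThetaLiftCont F T hT γ) = ratThetaLiftCont F (-T) (isUnit_det_neg T hT) (negOffDiag γ) :=
  Subtype.ext (adelicMpConj_ratThetaLiftCont F T hT γ)

/-! ## §3 The range form for [GelbartRogawski1991]'s section `i = ratSection` -/

/-- the range of `i_T = ratSection F T hT` is the range of `r_T` (the parametrisation `Sp_{2n}(F) ≃ Sp_F(W_T)` is onto). [cite: GelbartRogawski1991, §3.1 p. 454 L40–42] -/
theorem range_ratSection_eq : (ratSection F T hT).range = (ratThetaLiftCont F T hT).range := by
  apply le_antisymm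
  · rintro p ⟨x, rfl⟩
    exact ⟨_, rfl⟩
  · rintro p ⟨γ, rfl⟩
    exact ⟨⟨ratSp F T hT γ, γ, rfl⟩, ratSection_apply F T hT γ⟩

/-- `p ∈ range i_T → p ∈ range r_T`. [cite: GelbartRogawski1991, §3.1 p. 454 L40–42] -/
theorem mem_range_ratThetaLiftCont_of_mem_range_ratSection {p : adelicMpCont F (Fin n) T} (hp : p ∈ (ratSection F T hT).range) :
    p ∈ (ratThetaLiftCont F T hT).range :=
  (range_ratSection_eq F T hT).le hp

/-- `p ∈ range r_T → p ∈ range i_T`. [cite: GelbartRogawski1991, §3.1 p. 454 L40–42] -/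
theorem mem_range_ratSection_of_mem_range_ratThetaLiftCont {p : adelicMpCont F (Fin n) T}
    (hp : p ∈ (ratThetaLiftCont F T hT).range) : p ∈ (ratSection F T hT).range :=
  (range_ratSection_eq F T hT).symm.le hp

/-- `(r_T γ)ᶜ ∈ range r_{−T}`. [cite: Weil1964, Chap. III n° 40 p. 190, n° 41 Thm 6 p. 193] -/
theorem adelicMpContConj_ratThetaLiftCont_mem_range (γ : Matrix.symplecticGroup (Fin n) F) :
    adelicMpContConj F (Fin n) T (ratThetaLiftCont F T hT γ) ∈ (ratThetaLiftCont F (-T) (isUnit_det_neg T hT)).range :=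
  MonoidHom.mem_range.2 ⟨negOffDiag γ, (adelicMpContConj_ratThetaLiftCont F T hT γ).symm⟩

set_option maxHeartbeats 1600000 in
-- (the `−T`-instances of the Θ-lift are expensive to compare in `isDefEq`; term mode, explicit witness, generous budget)
/-- `p ∈ range r_T → pᶜ ∈ range r_{−T}`. [cite: Weil1964, Chap. III n° 40 p. 190, n° 41 Thm 6 p. 193] -/
theorem adelicMpContConj_mem_range_ratThetaLiftCont {p : adelicMpCont F (Fin n) T} (hp : p ∈ (ratThetaLiftCont F T hT).range) :
    adelicMpContConj F (Fin n) T p ∈ (ratThetaLiftCont F (-T) (isUnit_det_neg T hT)).range :=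
  Exists.elim (MonoidHom.mem_range.1 hp) fun γ hγ =>
    MonoidHom.mem_range.2
      ⟨negOffDiag γ, (adelicMpContConj_ratThetaLiftCont F T hT γ).symm.trans (congrArg (adelicMpContConj F (Fin n) T) hγ)⟩

/-- `(conj)⁻¹ (r_{−T} γ) = r_T (Λ γ Λ)`. [cite: Weil1964, Chap. III n° 40 p. 190, n° 41 Thm 6 p. 193] -/
theorem adelicMpContConj_symm_ratThetaLiftCont (γ : Matrix.symplecticGroup (Fin n) F) :
    (adelicMpContConj F (Fin n) T).symm (ratThetaLiftCont F (-T) (isUnit_det_neg T hT) γ) = ratThetaLiftCont F T hT (negOffDiag γ) :=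
  (adelicMpContConj F (Fin n) T).symm_apply_eq.2
    ((adelicMpContConj_ratThetaLiftCont F T hT (negOffDiag γ)).trans
      (congrArg (ratThetaLiftCont F (-T) (isUnit_det_neg T hT)) (negOffDiag_negOffDiag γ))).symm

set_option maxHeartbeats 1600000 in
-- (as above)
/-- `q ∈ range r_{−T} → (conj)⁻¹ q ∈ range r_T`. [cite: Weil1964, Chap. III n° 40 p. 190, n° 41 Thm 6 p. 193] -/
theorem adelicMpContConj_symm_mem_range_ratThetaLiftCont {q : adelicMpCont F (Fin n) (-T)}
    (hq : q ∈ (ratThetaLiftCont F (-T) (isUnit_det_neg T hT)).range) :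
    (adelicMpContConj F (Fin n) T).symm q ∈ (ratThetaLiftCont F T hT).range :=
  Exists.elim (MonoidHom.mem_range.1 hq) fun γ hγ =>
    MonoidHom.mem_range.2
      ⟨negOffDiag γ, (adelicMpContConj_symm_ratThetaLiftCont F T hT γ).symm.trans (congrArg (adelicMpContConj F (Fin n) T).symm hγ)⟩

/-- **complex conjugation carries `i_T(Sp_F(W))` into `i_{−T}(Sp_F(W⁻))`**: `p ∈ range i_T → pᶜ ∈ range i_{−T}` — the `ratPts` clause of
`SplittingDatum.IsCompatible` for a conjugate-transported splitting (its `proj` clause is `coe_proj_adelicMpContConj`).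
[cite: GelbartRogawski1991, §3.1 Prop. 3.1.1 p. 455 L1–3, Remark p. 457 L4] [cite: Weil1964, Chap. III n° 41 Thm 6 p. 193] -/
theorem adelicMpContConj_mem_range_ratSection {p : adelicMpCont F (Fin n) T} (hp : p ∈ (ratSection F T hT).range) :
    adelicMpContConj F (Fin n) T p ∈ (ratSection F (-T) (isUnit_det_neg T hT)).range :=
  mem_range_ratSection_of_mem_range_ratThetaLiftCont F (-T) (isUnit_det_neg T hT)
    (adelicMpContConj_mem_range_ratThetaLiftCont F T hT (mem_range_ratThetaLiftCont_of_mem_range_ratSection F T hT hp))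

/-- the inverse direction: `q ∈ range i_{−T} → (conj)⁻¹ q ∈ range i_T`. [cite: GelbartRogawski1991, §3.1 Prop. 3.1.1 p. 455 L1–3] -/
theorem adelicMpContConj_symm_mem_range_ratSection {q : adelicMpCont F (Fin n) (-T)}
    (hq : q ∈ (ratSection F (-T) (isUnit_det_neg T hT)).range) :
    (adelicMpContConj F (Fin n) T).symm q ∈ (ratSection F T hT).range :=
  mem_range_ratSection_of_mem_range_ratThetaLiftCont F T hT
    (adelicMpContConj_symm_mem_range_ratThetaLiftCont F T hT
      (mem_range_ratThetaLiftCont_of_mem_range_ratSection F (-T) (isUnit_det_neg T hT) hq))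

end Literature.NumberTheory.Weil1964

end
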